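import Summits.Ventures.PercRepro2.CaseOneStarCertT1
import Summits.Ventures.PercRepro2.CaseOneGadgetUWA1BBlockII0
import Summits.Ventures.PercRepro2.CaseOneGadgetUWA1BBlockII1
import Summits.Ventures.PercRepro2.CaseOneGadgetUWA1BBlockII2
import Summits.Ventures.PercRepro2.CaseOneGadgetUWA1BBlockII3
import Summits.Ventures.PercRepro2.CaseOneGadgetUWA1BBlockII4
import Summits.Ventures.PercRepro2.CaseOneGadgetUWA1BBlockII5
import Summits.Ventures.PercRepro2.CaseOneGadgetUWA1BBlockII6
import Summits.Ventures.PercRepro2.CaseOneGadgetUWA1BBlockII7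
import Summits.Ventures.PercRepro2.CaseOneGadgetUWA1BBlockII8
import Summits.Ventures.PercRepro2.CaseOneGadgetUWA1BBlockII9
import Summits.Ventures.PercRepro2.CaseOneGadgetUWA1BBlockII10
import Summits.Ventures.PercRepro2.CaseOneGadgetUWA1BBlockII11
import Summits.Ventures.PercRepro2.CaseOneGadgetUWA1BBlockII12
import Summits.Ventures.PercRepro2.CaseOneGadgetUWA1BBlockII13
import Summits.Ventures.PercRepro2.CaseOneGadgetUWA1BBlockII14
import Summits.Ventures.PercRepro2.CaseOneStarFactsB

/-!
# The gadget `u ~ {w, a₁, b}`, `w ~ {u, a₂, o}` (uwa1b): the cell certificates of `iiAB5` (part 34b)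
(blind cell PercRepro2, p1 g34; the fourth gadget anchor of the six-form calculus — all six forms of the uwa1b gadget
as plain SFacts-cone certificate chains, generated by mining/p1/g34/uwa1b/genu.py = p1 g33's gent_uwa1.py / g25's
geno.py re-targeted; P1-G33 §6–§6″, P1-G34)

Each `eBABII ijk kl` is a nonnegative combination of `(pairwise atom) × (cell)` and cubic cell monomials — or, for the degree-4 ones, `M × eBABII ijk kl` (`M = Σ cᵢ` the total cell mass) is a nonnegative combination of `(atom) × (cell) × (cell)` and quartic cell monomials, then `SFacts.nonneg_of_sum_mul` (`CaseOneStarCertT1`) — exact LP certificates (kit j318477, every certificate re-verified exactly; data/p1/g33/gcerts_ii_uwa1b.json, form `ii`), here as exact `linear_combination`s over `SFacts` (the rational coefficients cleared by their common denominator). -/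

namespace Summit.Ventures.PercRepro2

namespace CaseOne

section CertABII34b
variable {R : Type*} [Field R] [LinearOrder R] [IsStrictOrderedRing R]

set_option maxHeartbeats 0 in
/-- `eBABII23213 ≥ 0`: the combination is identically zero (`ring`). -/
lemma eBABII23213_nonneg (m : SCells R) (_hf : SFactsB m) : 0 ≤ eBABII23213 m := by
  have h : eBABII23213 m = 0 := by
    unfold eBABII23213 cBABII00113 cBABII00213 cBABII01013 cBABII01113 cBABII01213 cBABII02013 cBABII02113 cBABII02213 cBABII03113 cBABII03213 cBABII10013 cBABII10113 cBABII10213 cBABII11013 cBABII11113 cBABII11213 cBABII12013 cBABII12113 cBABII12213 cBABII13013 cBABII13113 cBABII13213 cBABII20013 cBABII20113 cBABII20213 cBABII21013 cBABII21113 cBABII21213 cBABII22013 cBABII22113 cBABII22213 cBABII23013 cBABII23113 cBABII23213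
    ring
  linarith [h]

set_option maxHeartbeats 0 in
/-- `eBABII23220 ≥ 0`: the combination is identically zero (`ring`). -/
lemma eBABII23220_nonneg (m : SCells R) (_hf : SFactsB m) : 0 ≤ eBABII23220 m := by
  have h : eBABII23220 m = 0 := by
    unfold eBABII23220 cBABII00120 cBABII00220 cBABII01020 cBABII01120 cBABII01220 cBABII02020 cBABII02120 cBABII02220 cBABII03120 cBABII03220 cBABII10120 cBABII10220 cBABII11020 cBABII11120 cBABII11220 cBABII12020 cBABII12120 cBABII12220 cBABII13020 cBABII13120 cBABII13220 cBABII20120 cBABII20220 cBABII21020 cBABII21120 cBABII21220 cBABII22020 cBABII22120 cBABII22220 cBABII23020 cBABII23120 cBABII23220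
    ring
  linarith [h]

end CertABII34b

end CaseOne

end Summit.Ventures.PercRepro2
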